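import Summits.HodgeConjecture.HodgeConjecture.Theses.AnchorTransport
import Summits.HodgeConjecture.HodgeConjecture.Theorems.AnchorTransportTargetIffHodgeConjecture
import Summits.HodgeConjecture.HodgeConjecture.Theorems.AnchorTransportAnchorExistenceTransport

/-!
# Route AnchorTransport — crux `AnchorExistence` (item stmt-HodgeConjecture-1077): LINE SKELETON `Sketch-peel-to-zero`

Lead skeleton of line `Sketch-peel-to-zero` (card `Cruxes/AnchorExistence/Ideas/peel-to-zero-chain-anchors.md`,
re-seat a2).  The crux `AnchorExistence` — every rational `(p,p)` class `c` on a smooth projective `X` of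
dimension `n` is, up to an iso `X ≅ 𝒳_{s₁}`, the restriction of a fibrewise rational `(p,p)` class `A` on the
total space of a smooth projective family `𝒳 ⟶ S` over a smooth irreducible base, ALGEBRAIC on some fibre
`𝒳_{s₀}` — is concluded BY NAME (`anchorTransport_anchorExistence_chain_proof`) from the card's CHAIN normal
form:

* a **Hodge pair** `P = (X, c)` (`ChainAnchor.HodgePair n p`) bundles a smooth projective `X` of dimension `n`
  with a rational `(p,p)` class `c ∈ H²ᵖ(X(ℂ); ℂ)`;
* a **hop** `Hop P Q` puts `P` and `Q` on two fibres of ONE smooth projective family over a smooth irreducible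
  base carrying ONE global fibrewise rational `(p,p)` class restricting to `P.c` and `Q.c` (the `∃`-body of the
  crux with the algebraicity clause replaced by a second marked fibre);
* a **surgery** `Surgery P Q` changes the class by an algebraic class across an iso `P.X ≅ Q.X`;
* `ChainAnchorAt P`: a finite chain of hops and surgeries from `P` ends at a pair whose class is algebraic;
  `ChainAnchorExistence := ∀ P, ChainAnchorAt P`.

KERNEL-CHECKED here (no `sorry`): `AnchorExistence → ChainAnchorExistence` (one hop to the anchor fibre);
`VariationalHodge → Step P Q → Q.c algebraic → P.c algebraic` (V pays a hop backwards, the group law pays a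
surgery, the route's PROVED `IsoInvariance` moves classes across isos); hence
`VariationalHodge → ChainAnchorExistence → AnchorExistence` (constant-family anchor of the now-algebraic
class) and `VariationalHodge → (ChainAnchorExistence ↔ AnchorExistence)`; and the residue certificate
`chainAnchorAt_iff_mem_algebraicClasses_of_stuck`: on a STUCK pair (every pair reachable by hops and
surgeries is `P` again up to an iso and an algebraic difference — e.g. `X` infinitesimally rigid and not
uniruled) a chain anchor exists IFF `c` is already algebraic, WITHOUT using `V`.

STUBS (registered; `sorry` only here): `anchorExistence_stub_variationalHodge : VariationalHodge` (the
route's other crux, item stmt-HodgeConjecture-1076 — every hop is paid by it);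
`anchorExistence_stub_chain_movable` (chains for NON-stuck pairs: the card's forcing geography
FORCING-FAT / FORCING-DARK + explicit Noether–Lefschetz termination, informal in the card);
`anchorExistence_stub_chain_stuck` (chains for STUCK pairs — by the residue certificate this is VERBATIM
"every rational `(p,p)` class on a stuck pair is algebraic", the Hodge conjecture there).
-/

noncomputable section

set_option linter.dupNamespace false

open CategoryTheory AlgebraicGeometry
open Literature.AlgebraicGeometry Literature.AlgebraicGeometry.Motives
  Literature.AlgebraicGeometry.HodgeTheory Literature.AlgebraicTopology.SingularHomology

namespace Summit.HodgeConjecture.HodgeConjecture.Theorems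

open Summit.HodgeConjecture.HodgeConjecture.Theses.AnchorTransport

namespace ChainAnchor

/-! ### The chain vocabulary (route-posited objects; to be homed in `Theorems/AnchorTransportDefs.lean`) -/

/-- A **Hodge pair** `(X, c)`: a smooth projective complex variety `X` of dimension `n` together with a
rational class `c ∈ H²ᵖ(X(ℂ); ℂ)` of Hodge type `(p,p)` — one instance of the hypotheses of the Hodge
conjecture / of the crux `AnchorExistence`. [cite: Deligne2000, §1] -/
structure HodgePair (n p : ℕ) where
  /-- the variety -/
  X : SchemeOver ℂ
  /-- the class in `H²ᵖ(X(ℂ); ℂ)` -/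
  c : complexBetti X (2 * p)
  /-- `X` is smooth projective of dimension `n` -/
  isSmoothProjective : IsSmoothProjective n X
  /-- `c` is a rational class -/
  isRationalClass : IsRationalClass c
  /-- `c` is of Hodge type `(p,p)` -/
  isOfHodgeType : IsOfHodgeType n X (2 * p) p p c

variable {n p : ℕ}

/-- A **hop** from `P` to `Q`: both pairs are fibres-with-class of ONE smooth projective family
`f : 𝒳 ⟶ S` of relative dimension `n` over a smooth irreducible `ℂ`-scheme carrying ONE global class
`A ∈ H²ᵖ(𝒳(ℂ); ℂ)` that is fibrewise rational of type `(p,p)`, with `e^*(A|_{𝒳_s}) = P.c` and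
`e'^*(A|_{𝒳_t}) = Q.c` (the `∃`-body of `AnchorExistence` with the algebraicity clause at the second
fibre replaced by a second marked pair). [cite: CharlesSchnell2014Notes, Conj. 11.3.1] -/
def Hop (P Q : HodgePair n p) : Prop :=
  ∃ (𝒳 S : SchemeOver ℂ) (f : 𝒳 ⟶ S) (s t : ComplexPoints S) (e : P.X ≅ fiberOver f s)
    (e' : Q.X ≅ fiberOver f t) (A : complexBetti 𝒳 (2 * p)),
    IsSmoothProjectiveFamily f n ∧ IrreducibleSpace S.left ∧ AlgebraicGeometry.Smooth S.hom ∧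
    (∀ u : ComplexPoints S, IsRationalClass (complexBetti.map (fiberι f u) (2 * p) A) ∧
      IsOfHodgeType n (fiberOver f u) (2 * p) p p (complexBetti.map (fiberι f u) (2 * p) A)) ∧
    complexBetti.map e.hom (2 * p) (complexBetti.map (fiberι f s) (2 * p) A) = P.c ∧
    complexBetti.map e'.hom (2 * p) (complexBetti.map (fiberι f t) (2 * p) A) = Q.c

/-- A **surgery** from `P` to `Q`: across an iso `e : P.X ≅ Q.X` the classes differ by an ALGEBRAIC
class, `P.c - e^*(Q.c) ∈ algebraicClasses P.X p` (subtracting a cycle-explained class at a special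
member). [cite: Deligne2000, §1] -/
def Surgery (P Q : HodgePair n p) : Prop :=
  ∃ e : P.X ≅ Q.X, P.c - complexBetti.map e.hom (2 * p) Q.c ∈ algebraicClasses P.X p

/-- One **step** of a chain: a hop or a surgery. [cite: Deligne2000, §1] -/
def Step (P Q : HodgePair n p) : Prop :=
  Hop P Q ∨ Surgery P Q

/-- `P` is **chain-anchored**: a finite chain of hops and surgeries from `P` reaches a pair whose class
is algebraic. [cite: CharlesSchnell2014Notes, Conj. 11.3.1] -/
def ChainAnchorAt (P : HodgePair n p) : Prop :=
  ∃ Q : HodgePair n p, Relation.ReflTransGen Step P Q ∧ Q.c ∈ algebraicClasses Q.X p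

/-- `P` is **stuck**: every pair reachable from `P` by hops and surgeries is `P` again up to an
isomorphism and an algebraic difference (no hop leaves the isomorphism class of `P.X` compatibly with the
classes modulo algebraic ones — e.g. `P.X` infinitesimally rigid and not uniruled, or `(X, c)` an isolated
point of its Hodge locus). [cite: BaldiKlinglerUllmo2024, Thm. 2.3] -/
def Stuck (P : HodgePair n p) : Prop :=
  ∀ Q : HodgePair n p, Relation.ReflTransGen Step P Q →
    ∃ g : Q.X ≅ P.X, Q.c - complexBetti.map g.hom (2 * p) P.c ∈ algebraicClasses Q.X p

variable (n p) in
/-- **Chain anchor existence** in bidegree `(n, p)`: every Hodge pair is chain-anchored.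
[cite: CharlesSchnell2014Notes, Conj. 11.3.1] -/
def ChainAnchorExistenceAt : Prop :=
  ∀ P : HodgePair n p, ChainAnchorAt P

/-- **Chain anchor existence**: every Hodge pair `(X, c)` is joined, by a finite chain of hops inside
smooth projective families carrying a global fibrewise-Hodge class and surgeries by algebraic classes, to a
pair whose class is algebraic (the card's `C⁺`). [cite: CharlesSchnell2014Notes, Conj. 11.3.1] -/
def ChainAnchorExistence : Prop :=
  ∀ n p : ℕ, ChainAnchorExistenceAt n p

/-! ### Kernel-checked glue -/

/-- The pair carried by the fibre `𝒳_u` of a smooth projective family with a global fibrewise rational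
`(p,p)` class `A`: `(𝒳_u, A|_{𝒳_u})`. [cite: CharlesSchnell2014Notes, Conj. 11.3.1] -/
def fiberPair {𝒳 S : SchemeOver ℂ} (f : 𝒳 ⟶ S) (hf : IsSmoothProjectiveFamily f n)
    (A : complexBetti 𝒳 (2 * p))
    (hA : ∀ u : ComplexPoints S, IsRationalClass (complexBetti.map (fiberι f u) (2 * p) A) ∧
      IsOfHodgeType n (fiberOver f u) (2 * p) p p (complexBetti.map (fiberι f u) (2 * p) A))
    (u : ComplexPoints S) : HodgePair n p :=
  ⟨fiberOver f u, complexBetti.map (fiberι f u) (2 * p) A, hf.isSmoothProjective u, (hA u).1, (hA u).2⟩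

/-- `(𝟙 X)^* x = x` on elements. [cite: FultonYoungTableaux1997, Appendix B §B.1 (1)] -/
theorem map_refl_apply {X : SchemeOver ℂ} (x : complexBetti X (2 * p)) :
    complexBetti.map (Iso.refl X).hom (2 * p) x = x := by
  rw [Iso.refl_hom, complexBetti.map_id]
  rfl

/-- `e.inv^* (e.hom^* x) = x` on elements. [cite: FultonYoungTableaux1997, Appendix B §B.1 (1)] -/
theorem map_inv_map_hom_apply {X Y : SchemeOver ℂ} (e : X ≅ Y) (x : complexBetti Y (2 * p)) :
    complexBetti.map e.inv (2 * p) (complexBetti.map e.hom (2 * p) x) = x := by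
  change (complexBetti.map e.hom (2 * p) ≫ complexBetti.map e.inv (2 * p)) x = x
  rw [← complexBetti.map_comp, Iso.inv_hom_id, complexBetti.map_id]
  rfl

/-- `e.hom^* (e.inv^* x) = x` on elements. [cite: FultonYoungTableaux1997, Appendix B §B.1 (1)] -/
theorem map_hom_map_inv_apply {X Y : SchemeOver ℂ} (e : X ≅ Y) (x : complexBetti X (2 * p)) :
    complexBetti.map e.hom (2 * p) (complexBetti.map e.inv (2 * p) x) = x :=
  map_inv_map_hom_apply e.symm x

/-- **An anchor datum is a one-hop chain**: `AnchorExistence → ChainAnchorExistence` (hop from `(X, c)`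
to the anchor fibre `(𝒳_{s₀}, A|_{𝒳_{s₀}})`, whose class is algebraic). [cite: CharlesSchnell2014Notes, Conj. 11.3.1] -/
theorem chainAnchorExistence_of_anchorExistence (hAn : AnchorExistence) : ChainAnchorExistence := by
  intro n p P
  obtain ⟨𝒳, S, f, s₁, s₀, e, A, hf, hirr, hsm, hfib, hAc, hs₀⟩ :=
    hAn P.isSmoothProjective p P.c P.isRationalClass P.isOfHodgeType
  refine ⟨fiberPair f hf A hfib s₀, Relation.ReflTransGen.single (Or.inl ?_), hs₀⟩
  exact ⟨𝒳, S, f, s₁, s₀, e, Iso.refl _, A, hf, hirr, hsm, hfib, hAc, map_refl_apply _⟩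

/-- **The Hodge conjecture gives chains of length zero.** [cite: Deligne2000, §1] -/
theorem chainAnchorExistence_of_hodgeConjecture (h : _root_.HodgeConjecture) : ChainAnchorExistence :=
  fun _ _ P ↦ ⟨P, Relation.ReflTransGen.refl,
    (h P.isSmoothProjective).2 _ P.c P.isRationalClass P.isOfHodgeType⟩

/-- **A surgery is paid by the group law**: if `Surgery P Q` and `Q.c` is algebraic then `P.c` is
algebraic (`P.c = (P.c - e^*Q.c) + e^*Q.c`, and `e^*` preserves algebraic classes by the route's proved
`IsoInvariance`). [cite: Fulton1998, §19.1] -/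
theorem mem_algebraicClasses_of_surgery {P Q : HodgePair n p} (h : Surgery P Q)
    (hQ : Q.c ∈ algebraicClasses Q.X p) : P.c ∈ algebraicClasses P.X p := by
  obtain ⟨e, he⟩ := h
  have h' : complexBetti.map e.hom (2 * p) Q.c ∈ algebraicClasses P.X p :=
    anchorTransport_isoInvariance_proof e p _ hQ
  simpa using (algebraicClasses P.X p).add_mem he h'

/-- **A hop is paid by the variational Hodge conjecture (backwards)**: if `Hop P Q` and `Q.c` is
algebraic then `A|_{𝒳_t} = e'⁻¹^*(Q.c)` is algebraic, `V` transports algebraicity of the global class `A`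
from the fibre `t` to the fibre `s`, and `P.c = e^*(A|_{𝒳_s})` is algebraic by `IsoInvariance`.
[cite: CharlesSchnell2014Notes, Conj. 11.3.1 and Prop. 11.3.5] -/
theorem mem_algebraicClasses_of_hop (hV : VariationalHodge) {P Q : HodgePair n p} (h : Hop P Q)
    (hQ : Q.c ∈ algebraicClasses Q.X p) : P.c ∈ algebraicClasses P.X p := by
  obtain ⟨𝒳, S, f, s, t, e, e', A, hf, hirr, hsm, hfib, hPs, hQt⟩ := h
  have ht : complexBetti.map (fiberι f t) (2 * p) A ∈ algebraicClasses (fiberOver f t) p := by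
    have h₁ := anchorTransport_isoInvariance_proof e'.symm p _ hQ
    rwa [← hQt, Iso.symm_hom, map_inv_map_hom_apply] at h₁
  have hs : complexBetti.map (fiberι f s) (2 * p) A ∈ algebraicClasses (fiberOver f s) p :=
    hV f hf hirr hsm p A hfib ⟨t, ht⟩ s
  rw [← hPs]
  exact anchorTransport_isoInvariance_proof e p _ hs

/-- **One step backwards** (hop: `V`; surgery: group law). [cite: CharlesSchnell2014Notes, Conj. 11.3.1] -/
theorem mem_algebraicClasses_of_step (hV : VariationalHodge) {P Q : HodgePair n p} (h : Step P Q)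
    (hQ : Q.c ∈ algebraicClasses Q.X p) : P.c ∈ algebraicClasses P.X p :=
  h.elim (fun hh ↦ mem_algebraicClasses_of_hop hV hh hQ) (fun hs ↦ mem_algebraicClasses_of_surgery hs hQ)

/-- **A whole chain backwards**: under `V`, a chain-anchored pair has an algebraic class (induction on
the chain from its algebraic end). [cite: CharlesSchnell2014Notes, Conj. 11.3.1] -/
theorem mem_algebraicClasses_of_chainAnchorAt (hV : VariationalHodge) {P : HodgePair n p}
    (h : ChainAnchorAt P) : P.c ∈ algebraicClasses P.X p := by
  obtain ⟨Q, hPQ, hQ⟩ := h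
  induction hPQ using Relation.ReflTransGen.head_induction_on with
  | refl => exact hQ
  | head hstep _ ih => exact mem_algebraicClasses_of_step hV hstep ih

/-- **Pointwise sandwich**: under `V`, `(X, c)` is chain-anchored iff `c` is algebraic.
[cite: CharlesSchnell2014Notes, Conj. 11.3.1 and Cor. 11.3.6] -/
theorem chainAnchorAt_iff_mem_algebraicClasses (hV : VariationalHodge) (P : HodgePair n p) :
    ChainAnchorAt P ↔ P.c ∈ algebraicClasses P.X p :=
  ⟨mem_algebraicClasses_of_chainAnchorAt hV, fun h ↦ ⟨P, Relation.ReflTransGen.refl, h⟩⟩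

/-- **Chains have the closing power of the crux, given `V`**: `VariationalHodge → ChainAnchorExistence →
AnchorExistence` (walk the chain back to make `c` algebraic on `X`, then anchor by the constant family,
`anchorTransport_anchor_of_mem_algebraicClasses`). [cite: CharlesSchnell2014Notes, Conj. 11.3.1] -/
theorem anchorExistence_of_chainAnchorExistence (hV : VariationalHodge) (hCh : ChainAnchorExistence) :
    AnchorExistence := by
  unfold AnchorExistence
  intro n X hX p c hc hpp
  -- the chain from the pair `⟨X, c⟩` makes `c` algebraic on `X` (projections reduced by `dsimp only`)
  have halg := mem_algebraicClasses_of_chainAnchorAt hV (hCh n p ⟨X, c, hX, hc, hpp⟩)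
  dsimp only at halg
  exact anchorTransport_anchor_of_mem_algebraicClasses hX p c hc hpp halg

/-- **Modulo `V` the crux IS the chain statement.** [cite: CharlesSchnell2014Notes, Conj. 11.3.1] -/
theorem chainAnchorExistence_iff_anchorExistence (hV : VariationalHodge) :
    ChainAnchorExistence ↔ AnchorExistence :=
  ⟨anchorExistence_of_chainAnchorExistence hV, chainAnchorExistence_of_anchorExistence⟩

/-- **The route's deciding theorem with `An` replaced by `ChainAn`**: same shape as
`AnchorTransport.closes`. [cite: CharlesSchnell2014Notes, Conj. 11.3.1] -/
theorem closes_of_chain (hV : VariationalHodge) (hCh : ChainAnchorExistence) (hIso : IsoInvariance)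
    (hM : HodgeModels) : _root_.HodgeConjecture :=
  closes hV (anchorExistence_of_chainAnchorExistence hV hCh) hIso hM

/-- **Residue certificate (no `V` needed): on a STUCK pair a chain anchor exists iff the class is already
algebraic.**  If every pair reachable from `P` is `P` up to an iso `g` and an algebraic difference, an
algebraic end `Q` of a chain gives `g^*(P.c) = Q.c - (Q.c - g^*P.c)` algebraic on `Q.X`, hence
`P.c = g⁻¹^*(g^* P.c)` algebraic on `P.X` (`IsoInvariance`); conversely the empty chain.  So the stub
`anchorExistence_stub_chain_stuck` below is VERBATIM the Hodge conjecture on stuck pairs.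
[cite: Fulton1998, §19.1] -/
theorem chainAnchorAt_iff_mem_algebraicClasses_of_stuck {P : HodgePair n p} (hP : Stuck P) :
    ChainAnchorAt P ↔ P.c ∈ algebraicClasses P.X p := by
  refine ⟨fun ⟨Q, hPQ, hQ⟩ ↦ ?_, fun h ↦ ⟨P, Relation.ReflTransGen.refl, h⟩⟩
  obtain ⟨g, hg⟩ := hP Q hPQ
  have h₁ : complexBetti.map g.hom (2 * p) P.c ∈ algebraicClasses Q.X p := by
    simpa using (algebraicClasses Q.X p).sub_mem hQ hg
  have h₂ := anchorTransport_isoInvariance_proof g.symm p _ h₁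
  rwa [Iso.symm_hom, map_inv_map_hom_apply] at h₂

/-- **The stuck part of `ChainAnchorExistence` is the Hodge conjecture on stuck pairs, on the nose.**
[cite: Fulton1998, §19.1] -/
theorem forall_stuck_chainAnchorAt_iff :
    (∀ (n p : ℕ) (P : HodgePair n p), Stuck P → ChainAnchorAt P) ↔
      ∀ (n p : ℕ) (P : HodgePair n p), Stuck P → P.c ∈ algebraicClasses P.X p :=
  forall₃_congr fun _ _ _ ↦ imp_congr_right fun hP ↦ chainAnchorAt_iff_mem_algebraicClasses_of_stuck hP

/-- `ChainAnchorExistence` splits losslessly into its movable and stuck parts (excluded middle on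
`Stuck P`). [cite: Deligne2000, §1] -/
theorem chainAnchorExistence_iff_movable_and_stuck :
    ChainAnchorExistence ↔
      (∀ (n p : ℕ) (P : HodgePair n p), ¬ Stuck P → ChainAnchorAt P) ∧
        (∀ (n p : ℕ) (P : HodgePair n p), Stuck P → ChainAnchorAt P) :=
  ⟨fun h ↦ ⟨fun n p P _ ↦ h n p P, fun n p P _ ↦ h n p P⟩,
    fun h n p P ↦ (em (Stuck P)).elim (h.2 n p P) (h.1 n p P)⟩

end ChainAnchor

open ChainAnchor

/-! ### Stubs (registered on stmt-HodgeConjecture-1077; `sorry` only here) -/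

/-- STUB (the route's other crux, item stmt-HodgeConjecture-1076, `AnchorTransport.VariationalHodge`):
Grothendieck's variational Hodge conjecture in global-class form — every hop of a chain is paid by it.
Not a worker's stub: it is an existing crux item of the route. [cite: CharlesSchnell2014Notes, Conj. 11.3.1] -/
theorem anchorExistence_stub_variationalHodge : VariationalHodge := by
  sorry

/-- STUB (the line's bet — FORCING GEOGRAPHY): every NON-stuck Hodge pair is chain-anchored: hop along a
positive-dimensional Hodge-locus component to a member acquiring a cycle-explained class not orthogonal to
the transported class, surger, repeat; terminate below the explicit Noether–Lefschetz threshold or at the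
zero class (card: FORCING-FAT via the Green / Ciliberto–Harris–Miranda density criterion or Kudla–Millson
positivity; FORCING-DARK on the finite BKU list of Hodge-homogeneous components). Informal in the card
("until the forcing vocabulary is fixed"); no Hodge-locus-dimension / IVHS vocabulary for it exists in the
tree. [cite: BaldiKlinglerUllmo2024, Thm. 2.3] -/
theorem anchorExistence_stub_chain_movable :
    ∀ (n p : ℕ) (P : HodgePair n p), ¬ Stuck P → ChainAnchorAt P := by
  sorry

/-- STUB (the line's declared RESIDUE `StuckPairsHC`): every STUCK Hodge pair is chain-anchored.  By
`forall_stuck_chainAnchorAt_iff` this is VERBATIM "every rational `(p,p)` class on a stuck pair is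
algebraic" — the Hodge conjecture on stuck pairs (rigid non-uniruled `X`, isolated Hodge-locus points),
which no entry of the card's `Leans on:` addresses. [cite: Deligne2000, §1] -/
theorem anchorExistence_stub_chain_stuck :
    ∀ (n p : ℕ) (P : HodgePair n p), Stuck P → ChainAnchorAt P := by
  sorry

/-! ### Composition (kernel-checked): the crux BY NAME from the three stubs -/

/-- `ChainAnchorExistence` from the movable and stuck stubs. [cite: Deligne2000, §1] -/
theorem anchorExistence_chainAnchorExistence_of_stubs : ChainAnchorExistence :=
  chainAnchorExistence_iff_movable_and_stuck.2
    ⟨anchorExistence_stub_chain_movable, anchorExistence_stub_chain_stuck⟩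

/-- **Line `Sketch-peel-to-zero` closes the crux modulo its stubs**: `AnchorExistence` BY NAME from
`V` (stub), forcing on movable pairs (stub) and the stuck residue (stub = HC on stuck pairs), through the
kernel-checked `anchorExistence_of_chainAnchorExistence`. [cite: CharlesSchnell2014Notes, Conj. 11.3.1] -/
theorem anchorTransport_anchorExistence_chain_proof : AnchorExistence :=
  anchorExistence_of_chainAnchorExistence anchorExistence_stub_variationalHodge
    anchorExistence_chainAnchorExistence_of_stubs

end Summit.HodgeConjecture.HodgeConjecture.Theorems

end
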